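import Mathlib.Analysis.MellinInversion
import Mathlib.Analysis.Convolution
import Literature.Analysis.Complex.LaplaceHalfLine
import HarnessLib

/-!
# Bromwich inversion of the half-line Laplace transform on a vertical line, and the Convolution Theorem

Topic `Literature/Analysis/Complex`, continuation of `LaplaceHalfLine.lean` (`laplaceC`, `HalfLineExpBound`). Everything here is
PROVED; cited by theorem number from J. L. Schiff, *The Laplace Transform: Theory and Applications* (Springer 1999) [Schiff1999].

* `mellin_laplacePullback` — the change of variables `x = e^{−t}`: `𝓛g(s) = mellin (laplacePullback g) s` where
  `laplacePullback g x = g(−log x)·𝟙_{x ≤ 1}` (so Mathlib's Mellin theory applies verbatim to half-line Laplace transforms);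
* `HalfLineExpBound.eq_integral_laplaceC_vertical` — **the complex (Fourier–Mellin / Bromwich) inversion formula with an
  absolutely convergent line integral**: for `ρ` continuous of exponential order `a₀ < a` with `y ↦ 𝓛ρ(a+iy)` integrable,
  `ρ(t) = (1/2π) ∫_ℝ e^{(a+iy)t} 𝓛ρ(a+iy) dy` for every `t > 0` (Schiff §4.1 (4.3); Mathlib's `mellinInv_mellin_eq`);
* `HalfLineExpBound.laplaceC_conv` — **the Convolution Theorem** `𝓛(k ⋆ r) = 𝓛k·𝓛r` on `Re s > γ` for `k, r` continuous
  of exponential order `γ`, `(k ⋆ r)(t) = ∫₀ᵗ k(t−u) r(u) du` (Schiff Thm 2.39; via Mathlib's `MeasureTheory.integral_convolution`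
  applied to `𝟙_{(0,∞)}e^{−s·}k` and `𝟙_{(0,∞)}e^{−s·}r`).

NOT here: residues / contour shifts (the tree's `VerticalLineShiftPoles.lean`), uniqueness of `𝓛` beyond what inversion gives,
operators or any model. Used by `Literature/Analysis/Convolution/RenewalResolventPole.lean`.
-/

noncomputable section

open _root_.Complex _root_.MeasureTheory _root_.Set _root_.Filter _root_.Real
open scoped _root_.Topology

namespace Literature.Analysis.Complex

/-! ### The Laplace transform as a Mellin transform; Bromwich inversion on a vertical line -/

section Inversion

/-- The pull-back of `g` to `(0,1]` along `x = e^{−t}`: `x ↦ g(−log x)` for `x ≤ 1`, `0` for `x > 1`. Its Mellin transform is the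
Laplace transform of `g` (`mellin_laplacePullback`). [cite: Schiff1999, §4.1 (4.2)–(4.3) (Fourier–Mellin inversion)] -/
def laplacePullback (g : ℝ → ℂ) (x : ℝ) : ℂ := if x ≤ 1 then g (-Real.log x) else 0

/-- `laplacePullback g (e^{−u}) = g u` for `u ≥ 0` and `= 0` for `u < 0`. [cite: Schiff1999, §4.1 (4.2)] -/
theorem laplacePullback_exp_neg (g : ℝ → ℂ) (u : ℝ) :
    laplacePullback g (Real.exp (-u)) = Set.indicator (Ici 0) g u := by
  unfold laplacePullback
  by_cases hu : 0 ≤ u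
  · rw [if_pos (by rw [Real.exp_le_one_iff]; linarith), Real.log_exp, neg_neg, Set.indicator_of_mem (by exact hu)]
  · rw [if_neg (by rw [not_le, Real.one_lt_exp_iff]; linarith), Set.indicator_of_notMem (by exact hu)]

/-- The substitution `u ↦ e^{−u}` maps `ℝ` onto `(0,∞)`. [folklore] -/
private theorem exp_neg_image : (fun u : ℝ => Real.exp (-u)) '' univ = Ioi 0 := by
  ext x
  constructor
  · rintro ⟨u, -, rfl⟩; exact Real.exp_pos _
  · intro hx
    exact ⟨-Real.log x, mem_univ _, by simp only [neg_neg]; exact Real.exp_log hx⟩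

/-- Derivative of the substitution `u ↦ e^{−u}`. [folklore] -/
private theorem exp_neg_hasDerivWithinAt :
    ∀ u ∈ (univ : Set ℝ), HasDerivWithinAt (fun u : ℝ => Real.exp (-u)) (-Real.exp (-u)) univ u :=
  fun u _ => by
    have h : HasDerivAt (fun u : ℝ => Real.exp (-u)) (Real.exp (-u) * -1) u :=
      (Real.hasDerivAt_exp (-u)).comp u (hasDerivAt_neg u)
    simpa using h

/-- The substitution `u ↦ e^{−u}` is injective. [folklore] -/
private theorem exp_neg_injOn : InjOn (fun u : ℝ => Real.exp (-u)) univ :=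
  fun u _ v _ h => by simpa using Real.exp_injective h

/-- The Mellin kernel pulled back along `x = e^{−u}`: `e^{−u} · (e^{−u})^{s−1} = e^{−su}`. [cite: Schiff1999, §4.1 (4.2)] -/
private theorem exp_mul_cpow (u : ℝ) (s : ℂ) :
    ((Real.exp (-u) : ℝ) : ℂ) * ((Real.exp (-u) : ℝ) : ℂ) ^ (s - 1) = cexp (-(s * u)) := by
  rw [Complex.ofReal_exp]
  have hne : cexp ((-u : ℝ) : ℂ) ≠ 0 := Complex.exp_ne_zero _
  calc cexp ((-u : ℝ) : ℂ) * cexp ((-u : ℝ) : ℂ) ^ (s - 1)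
      = cexp ((-u : ℝ) : ℂ) ^ (1 : ℂ) * cexp ((-u : ℝ) : ℂ) ^ (s - 1) := by rw [cpow_one]
    _ = cexp ((-u : ℝ) : ℂ) ^ (1 + (s - 1)) := by rw [cpow_add _ _ hne]
    _ = cexp (-(s * u)) := by
        rw [cpow_def_of_ne_zero hne, Complex.log_exp (by simp [Real.pi_pos]) (by simp [Real.pi_pos.le])]
        congr 1
        push_cast
        ring

/-- **The half-line Laplace transform is a Mellin transform**: `mellin (laplacePullback g) s = 𝓛g(s)` for every `s`
(change of variables `x = e^{−t}`; both sides are `0` together where divergent). [cite: Schiff1999, §4.1 (4.2)–(4.3)] -/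
theorem mellin_laplacePullback (g : ℝ → ℂ) (s : ℂ) : mellin (laplacePullback g) s = laplaceC g s := by
  rw [mellin, ← exp_neg_image, integral_image_eq_integral_abs_deriv_smul MeasurableSet.univ exp_neg_hasDerivWithinAt
    exp_neg_injOn, Measure.restrict_univ]
  rw [laplaceC, ← integral_Ici_eq_integral_Ioi, ← integral_indicator measurableSet_Ici]
  refine integral_congr_ae (Eventually.of_forall fun u => ?_)
  simp only [laplacePullback_exp_neg, abs_neg, abs_of_pos (Real.exp_pos _)]
  by_cases hu : u ∈ Ici (0 : ℝ)
  · rw [Set.indicator_of_mem hu, Set.indicator_of_mem hu, Complex.real_smul, smul_eq_mul, ← mul_assoc, exp_mul_cpow]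
  · rw [Set.indicator_of_notMem hu, Set.indicator_of_notMem hu, smul_zero, smul_zero]

/-- Absolute convergence of the Laplace integral of `ρ` at `Re s = a` is Mellin convergence of its pull-back at `a`.
[cite: Schiff1999, Theorem 1.11 / §4.1 (4.2)] -/
theorem HalfLineExpBound.mellinConvergent_laplacePullback {ρ : ℝ → ℂ} {R a₀ : ℝ} (h : HalfLineExpBound ρ R a₀)
    {a : ℝ} (ha : a₀ < a) : MellinConvergent (laplacePullback ρ) (a : ℂ) := by
  rw [MellinConvergent, ← exp_neg_image, integrableOn_image_iff_integrableOn_abs_deriv_smul MeasurableSet.univ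
    exp_neg_hasDerivWithinAt exp_neg_injOn, integrableOn_univ]
  have hpt : (fun u : ℝ => |(-Real.exp (-u))| • ((((Real.exp (-u) : ℝ) : ℂ)) ^ ((a : ℂ) - 1) • laplacePullback ρ (Real.exp (-u)))) =
      Set.indicator (Ici 0) (fun u : ℝ => cexp (-((a : ℂ) * u)) * ρ u) := by
    ext u
    simp only [laplacePullback_exp_neg, abs_neg, abs_of_pos (Real.exp_pos _)]
    by_cases hu : u ∈ Ici (0 : ℝ)
    · rw [Set.indicator_of_mem hu, Set.indicator_of_mem hu, Complex.real_smul, smul_eq_mul, ← mul_assoc, exp_mul_cpow]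
    · rw [Set.indicator_of_notMem hu, Set.indicator_of_notMem hu, smul_zero, smul_zero]
  rw [hpt, integrable_indicator_iff measurableSet_Ici, integrableOn_Ici_iff_integrableOn_Ioi]
  exact h.integrableOn (by simpa using ha)

/-- **Bromwich / Fourier–Mellin inversion on a vertical line.** Let `ρ` be continuous with `‖ρ(t)‖ ≤ R e^{a₀ t}` on `t ≥ 0`,
let `a > a₀`, and suppose `y ↦ 𝓛ρ(a + iy)` is integrable. Then for every `t > 0`,
`ρ(t) = (1/2π) ∫_ℝ e^{(a+iy)t} 𝓛ρ(a + iy) dy` (Mathlib's `mellinInv_mellin_eq` after `x = e^{−t}`).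
[cite: Schiff1999, §4.1 (4.3) (complex inversion formula)] -/
theorem HalfLineExpBound.eq_integral_laplaceC_vertical {ρ : ℝ → ℂ} {R a₀ : ℝ} (h : HalfLineExpBound ρ R a₀) {a : ℝ}
    (ha : a₀ < a) (hV : Integrable fun y : ℝ => laplaceC ρ (a + y * I)) {t : ℝ} (ht : 0 < t) :
    ρ t = (1 / (2 * π) : ℝ) • ∫ y : ℝ, cexp ((a + y * I) * t) * laplaceC ρ (a + y * I) := by
  have hx : 0 < Real.exp (-t) := Real.exp_pos _
  have hmell : mellin (laplacePullback ρ) = laplaceC ρ := funext (mellin_laplacePullback ρ)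
  have hVI : VerticalIntegrable (mellin (laplacePullback ρ)) a := by
    rw [hmell]; exact hV
  have hcont : ContinuousAt (laplacePullback ρ) (Real.exp (-t)) := by
    have hlt : Real.exp (-t) < 1 := by
      rw [← Real.exp_zero]; exact Real.exp_lt_exp.2 (by linarith)
    have heq : (fun x => ρ (-Real.log x)) =ᶠ[𝓝 (Real.exp (-t))] laplacePullback ρ := by
      filter_upwards [Iio_mem_nhds hlt] with x hx
      rw [laplacePullback, if_pos (le_of_lt hx)]
    refine ContinuousAt.congr ?_ heq
    exact h.continuous.continuousAt.comp ((Real.continuousAt_log hx.ne').neg)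
  have key := mellinInv_mellin_eq a (laplacePullback ρ) hx (h.mellinConvergent_laplacePullback ha) hVI hcont
  rw [laplacePullback, if_pos (by rw [Real.exp_le_one_iff]; linarith), Real.log_exp, neg_neg] at key
  rw [← key, mellinInv, hmell]
  congr 1
  refine integral_congr_ae (Eventually.of_forall fun y => ?_)
  simp only [smul_eq_mul]
  congr 1
  rw [cpow_def_of_ne_zero (by exact_mod_cast hx.ne'), Complex.ofReal_exp, Complex.log_exp (by simp [Real.pi_pos])
    (by simp [Real.pi_pos.le])]
  congr 1
  push_cast
  ring

end Inversion

/-! ### The convolution theorem -/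

section ConvolutionTheorem

open scoped Convolution

/-- The integrand identity behind the convolution theorem: with `F = 𝟙_{(0,∞)} e^{−s·} k`, `G = 𝟙_{(0,∞)} e^{−s·} r`,
`∫ F(u) G(x − u) du = 𝟙_{x > 0} e^{−sx} ∫₀ˣ k(x − u) r(u) du`. [cite: Schiff1999, Theorem 2.39 (proof)] -/
theorem convolution_indicator_eq (k r : ℝ → ℂ) (s : ℂ) (x : ℝ) :
    MeasureTheory.convolution (Set.indicator (Ioi 0) (fun u : ℝ => cexp (-(s * u)) * k u))
      (Set.indicator (Ioi 0) (fun u : ℝ => cexp (-(s * u)) * r u)) (ContinuousLinearMap.mul ℂ ℂ) volume x =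
      Set.indicator (Ioi 0) (fun x : ℝ => cexp (-(s * x)) * ∫ u in (0 : ℝ)..x, k (x - u) * r u) x := by
  rw [convolution_def]
  simp only [ContinuousLinearMap.mul_apply']
  -- the integrand is the indicator of `(0, x)` of `e^{−sx} k(u) r(x − u)`
  have hpt : ∀ u : ℝ, Set.indicator (Ioi 0) (fun u : ℝ => cexp (-(s * u)) * k u) u *
      Set.indicator (Ioi 0) (fun u : ℝ => cexp (-(s * u)) * r u) (x - u) =
      Set.indicator (Ioo 0 x) (fun u : ℝ => cexp (-(s * x)) * (k u * r (x - u))) u := by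
    intro u
    by_cases hu : u ∈ Ioo 0 x
    · rw [Set.indicator_of_mem hu, Set.indicator_of_mem (show u ∈ Ioi (0 : ℝ) from hu.1),
        Set.indicator_of_mem (show x - u ∈ Ioi (0 : ℝ) by simp only [mem_Ioi]; linarith [hu.2])]
      have : cexp (-(s * u)) * cexp (-(s * ((x - u : ℝ) : ℂ))) = cexp (-(s * x)) := by
        rw [← Complex.exp_add]; push_cast; ring_nf
      calc cexp (-(s * u)) * k u * (cexp (-(s * ((x - u : ℝ) : ℂ))) * r (x - u))
          = (cexp (-(s * u)) * cexp (-(s * ((x - u : ℝ) : ℂ)))) * (k u * r (x - u)) := by ring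
        _ = cexp (-(s * x)) * (k u * r (x - u)) := by rw [this]
    · rw [Set.indicator_of_notMem hu]
      by_cases h1 : u ∈ Ioi (0 : ℝ)
      · have h2 : x - u ∉ Ioi (0 : ℝ) := by
          simp only [mem_Ioi, not_lt, sub_nonpos]
          simp only [mem_Ioo, not_and, not_lt] at hu
          exact hu h1
        rw [Set.indicator_of_notMem h2, mul_zero]
      · rw [Set.indicator_of_notMem h1, zero_mul]
  simp_rw [hpt]
  rw [integral_indicator measurableSet_Ioo]
  by_cases hx : 0 < x
  · rw [Set.indicator_of_mem (show x ∈ Ioi (0 : ℝ) from hx), MeasureTheory.integral_const_mul,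
      ← integral_Ioc_eq_integral_Ioo, ← intervalIntegral.integral_of_le hx.le]
    congr 1
    rw [show (∫ u in (0 : ℝ)..x, k (x - u) * r u) = ∫ u in (0 : ℝ)..x, (fun v => k v * r (x - v)) (x - u) by
      refine intervalIntegral.integral_congr fun u _ => ?_
      simp only [sub_sub_cancel]]
    rw [intervalIntegral.integral_comp_sub_left (fun v => k v * r (x - v)) x, sub_self, sub_zero]
  · rw [Set.indicator_of_notMem (show x ∉ Ioi (0 : ℝ) from hx), Set.Ioo_eq_empty hx, Measure.restrict_empty,
      integral_zero_measure]

variable {k r : ℝ → ℂ} {K R γ : ℝ}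

/-- Integrability of `𝟙_{(0,∞)} e^{−s·} g` on the line for `g` of exponential order `< Re s`. [cite: Schiff1999, Theorem 1.11] -/
theorem HalfLineExpBound.integrable_indicator {g : ℝ → ℂ} {G : ℝ} (h : HalfLineExpBound g G γ) {s : ℂ} (hs : γ < s.re) :
    Integrable (Set.indicator (Ioi 0) (fun u : ℝ => cexp (-(s * u)) * g u)) :=
  (integrable_indicator_iff measurableSet_Ioi).2 (h.integrableOn hs)

/-- **The Convolution Theorem** `𝓛(k ⋆ r)(s) = 𝓛k(s)·𝓛r(s)` on `Re s > γ`, for `k, r` continuous of exponential order `γ`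
and `(k ⋆ r)(t) = ∫₀ᵗ k(t − u) r(u) du`. [cite: Schiff1999, Theorem 2.39] -/
theorem HalfLineExpBound.laplaceC_conv (hk : HalfLineExpBound k K γ) (hr : HalfLineExpBound r R γ) {s : ℂ} (hs : γ < s.re) :
    laplaceC (fun t : ℝ => ∫ u in (0 : ℝ)..t, k (t - u) * r u) s = laplaceC k s * laplaceC r s := by
  have key := MeasureTheory.integral_convolution (ContinuousLinearMap.mul ℂ ℂ) (hk.integrable_indicator hs)
    (hr.integrable_indicator hs) (μ := volume) (ν := volume)
  simp only [ContinuousLinearMap.mul_apply', integral_indicator measurableSet_Ioi] at key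
  rw [← laplaceC, ← laplaceC] at key
  rw [← key]
  have hpt := convolution_indicator_eq k r s
  rw [show MeasureTheory.convolution (Set.indicator (Ioi 0) (fun u : ℝ => cexp (-(s * u)) * k u))
      (Set.indicator (Ioi 0) (fun u : ℝ => cexp (-(s * u)) * r u)) (ContinuousLinearMap.mul ℂ ℂ) volume =
      Set.indicator (Ioi 0) (fun x : ℝ => cexp (-(s * x)) * ∫ u in (0 : ℝ)..x, k (x - u) * r u) from funext hpt,
    integral_indicator measurableSet_Ioi]
  rfl

end ConvolutionTheorem

end Literature.Analysis.Complex
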